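import Literature.AlgebraicGeometry.AbelianSchemes.SerreTensorIdealTranslationQuasiInverse   -- ★ `serreTranslateInv`, `isMonHom_serreTranslateInv`, `i_comp_serreTranslateInv`
import Literature.AlgebraicGeometry.AbelianSchemes.SerreTranslateCoverLeg                     -- ★ `isFinite_baseChangeHom_left`, `i_baseChange_comp_baseChangeHom`, `RingAction.baseChange`
import Literature.AlgebraicGeometry.GroupSchemes.SubPinCompCoverClosedImmersion                 -- ★ p850881 `isClosedImmersion_subpin_comp_cover_left`
import HarnessLib

/-!
# The SCALAR RETURN MAP `g_a` of the ideal translation `ψ_P : A → A ⊗_𝒪 𝔟` (`ψ_P ≫ g_a = ι(a)` for every `a ∈ 𝔭 = (P₁, …, P_m)`), over ANY base and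
# after ANY base change; corollary: a closed subscheme of `A ×_S S′` killed by an ideal prime to `𝔭` stays a CLOSED IMMERSION through `ψ_P ×_S S′`
# ([Conrad2004GrossZagier] §7 Thm. 7.5; [MumfordAV1970] §7 Thm. 4; [GortzWedhorn2020] Cor. 12.92)

Topic `AlgebraicGeometry/AbelianSchemes`, namespace `Literature.AlgebraicGeometry.AbelianSchemes.AbelianSchemeOver` (continues ★
`SerreTensorIdealTranslationQuasiInverse`).  THEOREMS ONLY (no definition, no instance, no notation, no named fact, no `sorry`); ANY base scheme `S`, any
commutative coefficient ring `𝒪`.  Cell `hodgecm-mathlib` (D-0151), F0∕P6 «MOD» (crux hLiu418 = stmt-HodgeConjecture-24832, `--supports`, count-neutral), line L2,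
organ (IMG) «IMAGE LINE ENGINE», piece **(T1-LS)** «the `hclosed` side condition of the (IMG) row at the MODEL cover leg `c̄_R = ψ_P ×_𝓨 x̃″`» (A-p06 (g36)
handoff 2026-09-02T10:40:49Z, A-p06 (g37)): generic floor.  HC_CM is proved only modulo the printed citations (2 remaining named inputs hLiu418 24832, h413 24833)
until rung 0 closes; this file is generic and changes no count.

## Mathematics

`ψ_P = (A ≅ A ⊗_𝒪 𝒪) ≫ (A ⊗ P) : A → A ⊗_𝒪 𝔟` is the Serre map of the column `P ∈ 𝔟 = E′·𝒪ᵐ` (`E′P = P`), with kernel `A[𝔭]`, `𝔭 := (P₁, …, P_m)` (★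
`SerreTensorIdealTranslationKernel`).  For a ROW `Q_a` with `Q_a E′ = Q_a` and `Q_a P = a` (a `1 × 1` scalar), the Serre map `ψ′_{Q_a} := (A ⊗ Q_a) ≫ (A ⊗_𝒪 𝒪 ≅ A)`
(★ `serreTranslateInv`) satisfies **`ψ_P ≫ ψ′_{Q_a} = ι(a)`** — the proof of ★ `serreTranslate_comp_serreTranslateInv` verbatim with a general scalar in place of
`N` (★ `serrePresentationHom_comp_of_quasiInverse` is stated for any `a`).  Such a row EXISTS FOR EVERY `a ∈ 𝔭`: write `a = Σ_k c_k P_k` and put `Q_a := c E′`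
(`Q_a E′ = c E′E′ = c E′`, `Q_a P = c E′P = c P = a`) — on the module side, `Hom_𝒪(𝔭⁻¹, 𝒪) = 𝔭` ([Conrad2004GrossZagier] §7 Thm. 7.5: «`ψ_P ∘ g_a = a`»).  Base
change along `g : S′ → S` is a monoidal functor, so `(ψ_P)_{S′} ≫ (ψ′_{Q_a})_{S′} = ι_{S′}(a)`.  COROLLARY (with ★ p850881 `isClosedImmersion_subpin_comp_cover_left`,
[GortzWedhorn2020] Cor. 12.92 «finite mono = closed immersion»): if `ψ_P` is finite, `ζ : Z ↪ A_{S′}` is a closed immersion killed by an ideal `𝔡` with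
`𝔭 + 𝔡 = (1)` (pick `a ∈ 𝔭`, `b ∈ 𝔡`, `a + b = 1`; then `ι(a)` fixes `ζ`), then `ζ ≫ (ψ_P)_{S′}` is a CLOSED IMMERSION.

## Contents
* §1 `exists_row_mul_eq_scalar_of_mem_span` (the row `Q_a = c E′`).
* §2 **`serreTranslate_comp_serreTranslateInv_of_mul_eq_scalar`** (`ψ_P ≫ ψ′_{Q_a} = ι(a)`), **`exists_returnMap_of_mem_span`** (for `a ∈ 𝔭`: a homomorphism
  `g_a` with `ψ_P ≫ g_a = ι(a)`, `𝒪`-equivariant).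
* §3 **`exists_returnMap_baseChangeHom_of_mem_span`** (the same after base change along `g : S′ → S`).
* §4 **`isClosedImmersion_comp_baseChangeHom_serreTranslate_left`** (the (T1) corollary at the model cover `(ψ_P)_{S′}`).

## References
* [Conrad2004GrossZagier] B. Conrad, *Gross–Zagier revisited*, MSRI Publ. 49 (2004), §7 (Thm. 7.5).
* [MumfordAV1970] D. Mumford, *Abelian Varieties* (1970), §7 Thm. 4 and the remark following it (p. 72).
* [GortzWedhorn2020] U. Görtz, T. Wedhorn, *Algebraic Geometry I*, 2nd ed. (2020), Cor. 12.92 and Prop. 12.94; Section (4.7) (pp. 107–108).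
* Tree: ★ `SerreTensorIdealTranslationQuasiInverse`, ★ `SerreTensorQuasiInverse` (FILE 13), ★ `SerreTranslateCoverLeg`, ★ `SubPinCompCoverClosedImmersion`.
-/

set_option autoImplicit false

noncomputable section

-- Mathlib's `Over`/pull-back API is stated across semireducible wrappers (as in the ★ `AbelianSchemes/*` files).
set_option backward.isDefEq.respectTransparency false

universe u

open CategoryTheory CategoryTheory.Limits AlgebraicGeometry MonoidalCategory CartesianMonoidalCategory
open scoped MonObj

namespace Literature.AlgebraicGeometry.AbelianSchemes

namespace AbelianSchemeOver

/-! ## §1 The row `Q_a = c E′` of a scalar `a ∈ (P₁, …, P_m)` (pure matrix algebra) -/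

/-- **For `a ∈ 𝔭 = (P₁, …, P_m)` there is a row `Q_a` with `Q_a E′ = Q_a` and `Q_a P = a`**: `a = Σ_k c_k P_k`, `Q_a := c E′` (`E′E′ = E′`, `E′P = P`).  Module
side: `Hom_𝒪(𝔟, 𝒪) ∋ (x ↦ Q_a x)` maps `P ↦ a`. [cite: Conrad2004GrossZagier, §7 (Thm. 7.5)] -/
theorem exists_row_mul_eq_scalar_of_mem_span {O : Type*} [CommRing O] {m : ℕ} (E' : Matrix (Fin m) (Fin m) O) (hE' : E' * E' = E')
    (P : Matrix (Fin m) (Fin 1) O) (hP : E' * P = P) {a : O} (ha : a ∈ Ideal.span (Set.range fun k => P k 0)) :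
    ∃ Qa : Matrix (Fin 1) (Fin m) O, Qa * E' = Qa ∧ Qa * P = Matrix.scalar (Fin 1) a := by
  classical
  obtain ⟨c, hc⟩ := Ideal.mem_span_range_iff_exists_fun.1 ha
  refine ⟨Matrix.of (fun (_ : Fin 1) k => c k) * E', by rw [Matrix.mul_assoc, hE'], ?_⟩
  rw [Matrix.mul_assoc, hP]
  ext i j
  rw [Fin.fin_one_eq_zero i, Fin.fin_one_eq_zero j, Matrix.mul_apply, Matrix.scalar_apply, Matrix.diagonal_apply_eq]
  simpa only [Matrix.of_apply] using hc

/-! ## §2 `ψ_P ≫ ψ′_{Q_a} = ι(a)` and the return map of a scalar `a ∈ 𝔭` -/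

section Base

variable {S : Scheme.{u}} {A : AbelianSchemeOver S} {O : Type*} [CommRing O] (act : A.RingAction O) [IsCommMonObj A.X]
  {m : ℕ} (E' : Matrix (Fin m) (Fin m) O) (hE' : E' * E' = E') (P : Matrix (Fin m) (Fin 1) O)

/-- **`ψ_P ≫ ψ′_{Q_a} = ι(a)`** for a row `Q_a` with `Q_a E′ = Q_a`, `Q_a P = a` — ★ `serreTranslate_comp_serreTranslateInv` with a general scalar `a` in place of the
integer `N` (★ `serrePresentationHom_comp_of_quasiInverse`, ★ `serreTensorOneIso_equivariant`). [cite: Conrad2004GrossZagier, §7 (Thm. 7.5)] [cite: MumfordAV1970, §7 Thm. 4 (p. 72)] -/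
theorem serreTranslate_comp_serreTranslateInv_of_mul_eq_scalar (Qa : Matrix (Fin 1) (Fin m) O) (hP : E' * P = P) (hQ : Qa * E' = Qa) {a : O}
    (hQP : Qa * P = Matrix.scalar (Fin 1) a) :
    serreTranslate act E' hE' P ≫ serreTranslateInv act E' hE' Qa = act.i a := by
  rw [serreTranslate, serreTranslateInv, Category.assoc, ← Category.assoc (serrePresentationHom act 1 _ E' hE' P),
    serrePresentationHom_comp_of_quasiInverse act (1 : Matrix (Fin 1) (Fin 1) O) one_mul_one_fin_one E' hE' P Qa
      (by rw [Matrix.mul_one]; exact hP) (by rw [Matrix.one_mul]; exact hQ.symm) (by rw [Matrix.mul_one]; exact hQP),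
    serreTensorOneIso_equivariant, Iso.inv_hom_id_assoc]

/-- **THE RETURN MAP OF A SCALAR `a ∈ 𝔭 = (P₁, …, P_m)`**: a homomorphism `g_a : A ⊗_𝒪 𝔟 → A` with `ψ_P ≫ g_a = ι(a)`, intertwining `ι_{A⊗𝔟}` with `ι` (namely
`ψ′_{Q_a}` for the row of §1). [cite: Conrad2004GrossZagier, §7 (Thm. 7.5)] [cite: MumfordAV1970, §7 Thm. 4 (p. 72)] -/
theorem exists_returnMap_of_mem_span (hP : E' * P = P) {a : O} (ha : a ∈ Ideal.span (Set.range fun k => P k 0)) :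
    ∃ g : (serreTensor act E' hE').X ⟶ A.X, IsMonHom g ∧ serreTranslate act E' hE' P ≫ g = act.i a ∧
      ∀ x : O, (serreAction act E' hE').i x ≫ g = g ≫ act.i x := by
  obtain ⟨Qa, hQ, hQP⟩ := exists_row_mul_eq_scalar_of_mem_span E' hE' P hP ha
  exact ⟨serreTranslateInv act E' hE' Qa, isMonHom_serreTranslateInv act E' hE' Qa,
    serreTranslate_comp_serreTranslateInv_of_mul_eq_scalar act E' hE' P Qa hP hQ hQP, fun x => i_comp_serreTranslateInv act E' hE' Qa hQ x⟩

end Base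

/-! ## §3 After base change along `g : S′ → S` -/

section BaseChange

variable {S S' : Scheme.{u}} (g : S' ⟶ S) {A : AbelianSchemeOver S} {O : Type*} [CommRing O] (act : A.RingAction O) [IsCommMonObj A.X]
  {m : ℕ} (E' : Matrix (Fin m) (Fin m) O) (hE' : E' * E' = E') (P : Matrix (Fin m) (Fin 1) O)

/-- **THE RETURN MAP OF `a ∈ 𝔭` AT THE BASE-CHANGED COVER `(ψ_P)_{S′} : A_{S′} → (A ⊗_𝒪 𝔟)_{S′}`**: a homomorphism `g` with `(ψ_P)_{S′} ≫ g = ι_{S′}(a)`, intertwining the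
base-changed actions (base change of §2 along the monoidal functor `×_S S′`). [cite: Conrad2004GrossZagier, §7 (Thm. 7.5)] [cite: GortzWedhorn2020, Section (4.7) (pp. 107–108)] -/
theorem exists_returnMap_baseChangeHom_of_mem_span (hP : E' * P = P) {a : O} (ha : a ∈ Ideal.span (Set.range fun k => P k 0)) :
    ∃ g' : ((serreTensor act E' hE').baseChange g).X ⟶ (A.baseChange g).X,
      IsMonHom g' ∧ baseChangeHom (serreTranslate act E' hE' P) g ≫ g' = (act.baseChange g).i a ∧
        ∀ x : O, ((serreAction act E' hE').baseChange g).i x ≫ g' = g' ≫ (act.baseChange g).i x := by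
  obtain ⟨g₀, hg₀, hψg₀, hxg₀⟩ := exists_returnMap_of_mem_span act E' hE' P hP ha
  haveI := hg₀
  refine ⟨baseChangeHom g₀ g, isMonHom_baseChangeHom g₀ g, ?_, fun x => i_baseChange_comp_baseChangeHom g _ _ g₀ x (hxg₀ x)⟩
  rw [RingAction.baseChange_i]
  change (Over.pullback g).map (serreTranslate act E' hE' P) ≫ (Over.pullback g).map g₀ = (Over.pullback g).map (act.i a)
  rw [← Functor.map_comp, hψg₀]

/-! ## §4 (T1) A closed subscheme of `A_{S′}` killed by an ideal prime to `𝔭` stays a closed immersion through `(ψ_P)_{S′}` -/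

/-- **(T1) THE `hclosed` SIDE CONDITION AT THE MODEL COVER.**  `ψ_P : A → A ⊗_𝒪 𝔟` finite (e.g. ★ `isFinite_serreTranslate_left` from a quasi-inverse row), `𝔡` an
ideal with `𝔭 + 𝔡 = (1)` (`𝔭 = (P₁, …, P_m)`), `ζ : Z → A_{S′}` over `S′` with `ζ.left` a CLOSED IMMERSION and KILLED BY `𝔡` (`ζ ≫ ι_{S′}(x) = 1`, `x ∈ 𝔡`; e.g.
`V(J) ↪ A_{S′}[𝔡] ↪ A_{S′}`).  Then `(ζ ≫ (ψ_P)_{S′}).left` is a closed immersion: pick `a ∈ 𝔭`, `b ∈ 𝔡`, `a + b = 1`, the return map `g_a` of §3 has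
`(ψ_P)_{S′} ≫ g_a = ι_{S′}(a)` and `ι_{S′}(a)` fixes `ζ`, so `ζ ≫ (ψ_P)_{S′}` is a finite monomorphism (★ p850881 `isClosedImmersion_subpin_comp_cover_left`, Mathlib
`IsClosedImmersion.iff_isFinite_and_mono`). [cite: GortzWedhorn2020, Cor. 12.92 and Prop. 12.94] [cite: Conrad2004GrossZagier, §7 (Thm. 7.5)] -/
theorem isClosedImmersion_comp_baseChangeHom_serreTranslate_left (hP : E' * P = P) [IsFinite (serreTranslate act E' hE' P).left]
    {𝔡 : Ideal O} (h𝔭𝔡 : Ideal.span (Set.range fun k => P k 0) ⊔ 𝔡 = ⊤)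
    {Z : Over S'} (ζ : Z ⟶ (A.baseChange g).X) [IsClosedImmersion ζ.left] (hζ : ∀ x ∈ 𝔡, ζ ≫ (act.baseChange g).i x = 1) :
    IsClosedImmersion (ζ ≫ baseChangeHom (serreTranslate act E' hE' P) g).left := by
  obtain ⟨a, ha, b, hb, hab⟩ := Submodule.mem_sup.mp ((Ideal.eq_top_iff_one _).mp h𝔭𝔡)
  obtain ⟨g', -, hψg', -⟩ := exists_returnMap_baseChangeHom_of_mem_span g act E' hE' P hP ha
  haveI : IsFinite (baseChangeHom (serreTranslate act E' hE' P) g).left := isFinite_baseChangeHom_left g _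
  exact Literature.AlgebraicGeometry.GroupSchemes.IdealKernelLayerMap.isClosedImmersion_subpin_comp_cover_left 𝔡 (fun x => (act.baseChange g).i x)
    (fun x y => (act.baseChange g).i_add x y) (act.baseChange g).i_one ζ hζ (baseChangeHom (serreTranslate act E' hE' P) g) g' hab hb hψg'

end BaseChange

end AbelianSchemeOver

end Literature.AlgebraicGeometry.AbelianSchemes

end
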